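import Summits.HodgeConjecture.HodgeConjecture.Theorems.NoetherLefschetzOneUpK3TypeNetsOddPrimeTranscendental
import Summits.HodgeConjecture.HodgeConjecture.Theorems.NikulinTwinTransportSquareGlueFree
import Literature.AlgebraicGeometry.Surfaces.K3HodgeTypesHolds
import Literature.AlgebraicGeometry.Surfaces.K3MarkingProofs
import Literature.AlgebraicGeometry.HodgeTheory.HypersurfaceHolomorphicFormsProofs
import Literature.AlgebraicGeometry.Surfaces.K3LatticeInvariants

/-!
# Squares of surfaces with `p_g = 1` and `b₂ − ρ` an odd prime, II: the Hodge conjecture for `S × S`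

Sequel of `…K3TypeNetsOddPrimeTranscendental` (crux `K3TypeNets`, stmt-HodgeConjecture-11600, product
sector). There: for a smooth projective complex surface `S` with `h^{2,0}(S) = 1` and `b₂(S) − ρ(S)` an
odd prime, the transcendental lattice `T(S)_ℚ` underlies a sub-Hodge structure of `H²_B(S)` all of whose
Hodge endomorphisms are rational scalars (`exists_transcendental_hom_eq_smul`). Here this is carried to
`H²(S(ℂ); ℂ)` and fed to the marking-free bookkeeping of route NikulinTwinTransport
(`SquareGlueFree.hodgeConjectureFor_square_of_hodgeEndomorphisms_scalar`, seat ring2-b02 gen 47: "HC for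
`S × S` ⟸ `End_Hdg(T(S)) = ℚ`", Varesco 2023 §2 p. 8):

* `exists_ratEnd_of_isRationalClass` — a `ℂ`-linear endomorphism of `H²(S(ℂ); ℂ)` preserving rational
  classes is `Θ ∘ (g ⊗ ℂ) ∘ Θ⁻¹` for a `ℚ`-linear `g` on `H²(S(ℂ); ℚ)`;
* `hodgeEndomorphisms_scalar` — **every rational, type-preserving endomorphism of `H²(S(ℂ); ℂ)`
  killing `N¹H²` with image orthogonal to `N¹H²` acts on `T(S) = (N¹H²)^⊥` as a rational scalar**, for
  `S` as above (`g ∈ End_Hdg(H²_B(S))` maps into `T(S)_ℚ`, restrict, `End_Hdg(T(S)_ℚ) = ℚ`);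
* `hodgeConjectureFor_square_of_prime` — **THE HODGE CONJECTURE FOR `S × S`, for every smooth
  projective complex surface `S` with `h^{2,0}(S) = 1` and `b₂(S) − ρ(S)` an odd prime**, in every
  codimension, unconditionally;
* `hodgeConjectureFor_square_of_isK3Surface_of_prime` — in particular for every complex projective K3
  surface `S` (tree predicate `IsK3Surface`) with `b₂(S) − ρ(S)` an odd prime, i.e. (as `b₂ = 22`)
  Picard number `ρ(S) ∈ {3, 5, 9, 11, 15, 17, 19}` — e.g. `ρ = 17, 19`, two of the four Picard numbers
  of the support item `ELineTransport.HighPicardSquares` (stmt-HodgeConjecture-12553), with no appeal to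
  Kuga–Satake, Shioda–Inose or CM.

No definition, no named-fact hypothesis, no sorry. Prover seat ring2-b02 (gen 48).

References: D. Huybrechts, *Lectures on K3 Surfaces*, Ch. 3 Lemma 3.1, (3.2), Rem. 3.14 (ii); B. van
Geemen, *Real multiplication on K3 surfaces and Kuga–Satake varieties* (2008), Lemma 3.2; M. Varesco,
*Hodge similitudes and the Hodge conjecture for squares of K3 surfaces* (2023), §2; C. Voisin, *Hodge
Theory and Complex Algebraic Geometry I*, §7.1, §11.3.
-/

set_option linter.dupNamespace false

noncomputable section

namespace Summit.HodgeConjecture.HodgeConjecture.Theorems.OddPrimeSquares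

open scoped TensorProduct
open CategoryTheory MonoidalCategory Literature.AlgebraicGeometry Literature.AlgebraicGeometry.Motives
open Literature.AlgebraicGeometry.HodgeTheory Literature.AlgebraicTopology.SingularHomology
open Literature.AlgebraicGeometry.Motives.HodgeStructure Literature.AlgebraicGeometry.Surfaces

variable {S : SchemeOver ℂ}

/-- `H²_B(S)`: the weight-two `ℚ`-Hodge structure on `H²(S(ℂ); ℚ)` of the real Hodge model of `S`. -/
local notation3 "H²[" hS "]" =>
  bettiTwoHodgeStructure hS (BettiUniverse.realHodgeModel exists_isReal_hodgeModel_holds hS)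
    (BettiUniverse.realHodgeModel_isHodgeSymmetric exists_isReal_hodgeModel_holds hS)

/-- `T(S)_ℚ = Hdg¹^⊥ ⊆ H²(S(ℂ); ℚ)`. -/
local notation3 "T[" hS "]" =>
  transcendentalLatticeBetti hS (BettiUniverse.realHodgeModel exists_isReal_hodgeModel_holds hS)
    (BettiUniverse.realHodgeModel_isHodgeSymmetric exists_isReal_hodgeModel_holds hS)

/-- `Θ : ℂ ⊗_ℚ H²(S(ℂ); ℚ) → H²(S(ℂ); ℂ)`. -/
local notation3 "Θ[" S "]" => ofRatClassBaseChange (Motives.ComplexPoints S) (2 * 1)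

/-! ### Descent of rational endomorphisms -/

/-- **An endomorphism of `H²(S(ℂ); ℂ)` preserving rational classes is the complexification of a
`ℚ`-linear endomorphism of `H²(S(ℂ); ℚ)`**: `f ∘ Θ = Θ ∘ (g ⊗ ℂ)` (pointwise preimages along the
injective `a ↦ a ⊗ 1`). [cite: HatcherAT2002, §3.1 p. 198] [cite: VoisinHodgeI2002, §7.1.1] -/
theorem exists_ratEnd_of_isRationalClass (f : complexBetti S (2 * 1) →ₗ[ℂ] complexBetti S (2 * 1))
    (hf : ∀ y, IsRationalClass y → IsRationalClass (f y)) :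
    ∃ g : bettiCohomology S (2 * 1) →ₗ[ℚ] bettiCohomology S (2 * 1),
      (∀ v, ofRatClass (Motives.ComplexPoints S) (2 * 1) (g v) = f (ofRatClass (Motives.ComplexPoints S) (2 * 1) v)) ∧
      ∀ x, f (Θ[S] x) = Θ[S] (g.baseChange ℂ x) := by
  have hE : ∀ a : bettiCohomology S (2 * 1), ∃ b : bettiCohomology S (2 * 1),
      ofRatClass (Motives.ComplexPoints S) (2 * 1) b = f (ofRatClass (Motives.ComplexPoints S) (2 * 1) a) :=
    fun a ↦ by
      obtain ⟨b, hb⟩ := (isRationalClass_iff_mem_range_ofRatClass _).1 (hf _ (isRationalClass_ofRatClass a))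
      exact ⟨b, hb⟩
  choose t ht using hE
  have hinj := ofRatClass_injective (Y := Motives.ComplexPoints S) (2 * 1)
  let g : bettiCohomology S (2 * 1) →ₗ[ℚ] bettiCohomology S (2 * 1) :=
    { toFun := t
      map_add' := fun a b ↦ hinj (by rw [ht, map_add, map_add, map_add, ht, ht])
      map_smul' := fun q a ↦ hinj (by
        rw [ht, Motives.ofRatClass_smul, map_smul, RingHom.id_apply, Motives.ofRatClass_smul, ht]) }
  refine ⟨g, fun v ↦ ht v, fun x ↦ ?_⟩
  induction x using TensorProduct.induction_on with
  | zero => simp only [map_zero]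
  | tmul c a =>
    rw [ofRatClassBaseChange_tmul, map_smul, LinearMap.baseChange_tmul, ofRatClassBaseChange_tmul]
    exact congrArg (c • ·) (ht a).symm
  | add x y hx hy => rw [map_add, map_add, hx, hy, map_add, map_add]

/-! ### `End_Hdg(T(S)) = ℚ` on `H²(S(ℂ); ℂ)` -/

/-- **Hodge endomorphisms of `H²(S(ℂ); ℂ)` act on `T(S) = (N¹H²)^⊥` as rational scalars** when `S` is a
smooth projective surface with `h^{2,0}(S) = 1` (the `(2,0)`-classes are the line `ℂσ`) and
`b₂(S) − ρ(S) = dim_ℂ H²(S(ℂ); ℂ) − dim_ℂ N¹H²(S(ℂ); ℂ)` is an odd prime: for every `ℂ`-linear `f`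
preserving rational classes and Hodge types, with image cup-orthogonal to `N¹H²`,
there is `a ∈ ℚ` with `f y = a y` for all `y ⊥ N¹H²` (the clause "`f` kills `N¹H²`" of `hU₀` is not
even needed) — the hypothesis `hU₀` of
`SquareGlueFree.hodgeConjectureFor_square_of_hodgeEndomorphisms_scalar`. Proof: `f = Θ (g ⊗ ℂ) Θ⁻¹`
with `g ∈ End_Hdg(H²_B(S))`, `g(H²) ⊆ T(S)_ℚ = Hdg¹^⊥` (Lefschetz `(1,1)`: `Θ(Hdg¹_ℂ) = N¹H²`), so
`g|_T ∈ End_Hdg(T(S)_ℚ) = ℚ` (`exists_transcendental_hom_eq_smul`), and `Θ(T(S)_ℂ) = (N¹H²)^⊥`.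
[cite: Huybrechts2016K3, Ch. 3 Lemma 3.1 and Rem. 3.3.14 (ii)] [cite: Vangeemen2008, Lemma 3.2]
[cite: VoisinHodgeI2002, Thm. 11.30] -/
theorem hodgeEndomorphisms_scalar (hS : IsSmoothProjective 2 S) {σ : complexBetti S (2 * 1)}
    (hσ : IsOfHodgeType 2 S (2 * 1) 2 0 σ) (hσ0 : σ ≠ 0)
    (hline : ∀ c : complexBetti S (2 * 1), IsOfHodgeType 2 S (2 * 1) 2 0 c → ∃ t : ℂ, c = t • σ)
    (hp : (Module.finrank ℂ (complexBetti S (2 * 1)) - Module.finrank ℂ (algebraicClasses S 1)).Prime)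
    (hodd : Odd (Module.finrank ℂ (complexBetti S (2 * 1)) - Module.finrank ℂ (algebraicClasses S 1)))
    (f : complexBetti S (2 * 1) →ₗ[ℂ] complexBetti S (2 * 1))
    (hf₁ : ∀ y, IsRationalClass y → IsRationalClass (f y))
    (hf₂ : ∀ (i j : ℕ) y, IsOfHodgeType 2 S (2 * 1) i j y → IsOfHodgeType 2 S (2 * 1) i j (f y))
    (hf₄ : ∀ y : complexBetti S (2 * 1), ∀ d ∈ algebraicClasses S 1,
      cupProduct (rfl : 2 * 1 + 2 * 1 = 2 * 2) (f y) d = 0) :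
    ∃ a : ℚ, ∀ y : complexBetti S (2 * 1),
      (∀ d ∈ algebraicClasses S 1, cupProduct (rfl : 2 * 1 + 2 * 1 = 2 * 2) y d = 0) →
      f y = (a : ℂ) • y := by
  haveI : Module.Finite ℚ (bettiCohomology S (2 * 1)) := BettiUniverse.finite hS (2 * 1)
  set M := BettiUniverse.realHodgeModel exists_isReal_hodgeModel_holds hS with hMdef
  have hI := hodgePQ_independent_of_hodgeModel_holds
  have h4 : 2 * 1 + 2 * 1 = 2 * 2 := rfl
  -- (1) descend `f` to `g` on `H²(S(ℂ); ℚ)`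
  obtain ⟨g, hgofRat, hg⟩ := exists_ratEnd_of_isRationalClass f hf₁
  -- (2) `g` preserves the Hodge filtration: `g ∈ End_Hdg(H²_B(S))`
  have hgF : ∀ p : ℤ, ((H²[hS]).F p).map (g.baseChange ℂ) ≤ (H²[hS]).F p := by
    intro p
    rintro _ ⟨x, hx, rfl⟩
    change x ∈ (BettiUniverse.hodge exists_isReal_hodgeModel_holds hS (2 * 1)).F p at hx
    change g.baseChange ℂ x ∈ (BettiUniverse.hodge exists_isReal_hodgeModel_holds hS (2 * 1)).F p
    rw [BettiUniverse.hodge_F, HodgeModel.ratF_eq_iSup] at hx ⊢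
    induction hx using Submodule.iSup_induction' with
    | mem pq x hx =>
      by_cases hp' : p ≤ (pq.1.1 : ℤ)
      · rw [iSup_pos hp'] at hx
        refine Submodule.mem_iSup_of_mem pq (Submodule.mem_iSup_of_mem hp' ?_)
        rw [HodgeModel.mem_ratPiece_iff, HodgeModel.complexification_apply] at hx ⊢
        have h1 : IsOfHodgeType 2 S (2 * 1) pq.1.1 pq.1.2 (Θ[S] x) := ⟨M, hx⟩
        have h2 := hf₂ _ _ _ h1
        rw [hg] at h2
        obtain ⟨B, hB⟩ := h2
        exact hI 2 S hS B M (2 * 1) _ _ _ hB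
      · rw [iSup_neg hp', Submodule.mem_bot] at hx
        rw [hx, map_zero]
        exact Submodule.zero_mem _
    | zero => rw [map_zero]; exact Submodule.zero_mem _
    | add x y _ _ hx hy => rw [map_add]; exact Submodule.add_mem _ hx hy
  have hgend : g ∈ (H²[hS]).endAlg := (mem_endAlg_iff _ _).2 hgF
  -- (3) `Θ(1 ⊗ Hdg¹) ⊆ N¹H²`; `g` kills `Hdg¹` and maps `H²` into `T(S)_ℚ = Hdg¹^⊥`
  have hN : ∀ h ∈ (H²[hS]).hodgeClasses 1,
      ofRatClass (Motives.ComplexPoints S) (2 * 1) h ∈ algebraicClasses S 1 := fun h hh ↦ by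
    rw [← map_hodgeClasses_baseChange_eq_algebraicClasses hS]
    exact ⟨(1 : ℂ) ⊗ₜ h, Submodule.tmul_mem_baseChange_of_mem 1 hh,
      by rw [ofRatClassBaseChange_tmul, one_smul]⟩
  have hgT : ∀ v, g v ∈ T[hS] := fun v ↦ by
    rw [mem_transcendentalLatticeBetti_iff]
    intro h hh
    rw [cupPairingBetti_apply]
    have hc : cupProduct (X := Motives.ComplexPoints S) (R := ℚ) h4 h (g v) = 0 := by
      apply ofRatClass_injective (Y := Motives.ComplexPoints S) (2 * 2)
      rw [map_zero, ofRatClass_eq_ringChange, singularCohomology.ringChange_cupProduct,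
        ← ofRatClass_eq_ringChange, ← ofRatClass_eq_ringChange, hgofRat,
        cupProduct_gradedComm_holds ℂ (Motives.ComplexPoints S) h4 h4, hf₄ _ _ (hN h hh), smul_zero]
    rw [hc, map_zero]
  -- (4) `End_Hdg(T(S)_ℚ) = ℚ`: the restriction of `g` to `T` is `q · id`
  obtain ⟨T, hT, hscal⟩ := exists_transcendental_hom_eq_smul hS hσ hσ0 hline hp hodd
  have hgT' : ∀ v, g v ∈ T.toSubmodule := fun v ↦ by rw [hT]; exact hgT v
  let g' : Hom T.toHodgeStructure T.toHodgeStructure :=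
    ((endAlg.toHom ⟨g, hgend⟩).comp T.subtypeHom).codRestrict T fun t ↦ hgT' _
  obtain ⟨q, hq⟩ := hscal g'
  have hgq : ∀ t : T.toSubmodule, g (t : bettiCohomology S (2 * 1)) = q • (t : bettiCohomology S (2 * 1)) := by
    intro t
    have h1 := LinearMap.congr_fun hq t
    have h2 : ((g'.toLinearMap t : T.toSubmodule) : bettiCohomology S (2 * 1)) = g t := rfl
    rw [← h2, h1, LinearMap.smul_apply, LinearMap.id_apply, Submodule.coe_smul]
  refine ⟨q, fun y hy ↦ ?_⟩
  -- (5) `y ⊥ N¹H²` gives `Θ⁻¹ y ∈ T(S)_ℂ`, on which `g ⊗ ℂ = q`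
  obtain ⟨x, rfl⟩ := ofRatClassBaseChange_surjective hS (2 * 1) y
  have hxT : x ∈ T.toSubmodule.baseChange ℂ := by
    rw [hT, transcendentalLatticeBetti, baseChange_orthogonal_eq _ (cupPairingBetti_nondegenerate hS),
      LinearMap.BilinForm.mem_orthogonal_iff]
    intro z hz
    apply cupPairingBetti_baseChange_eq_zero_of_cup hS
    rw [cup_baseChange_eq_zero_iff]
    have hzN : Θ[S] z ∈ algebraicClasses S 1 := by
      rw [← map_hodgeClasses_baseChange_eq_algebraicClasses hS]
      exact ⟨z, hz, rfl⟩
    rw [cupProduct_gradedComm_holds ℂ (Motives.ComplexPoints S) h4 h4, hy _ hzN, smul_zero]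
  obtain ⟨u, rfl⟩ := hxT
  have hgx : g.baseChange ℂ (T.toSubmodule.subtype.baseChange ℂ u) =
      (q : ℂ) • T.toSubmodule.subtype.baseChange ℂ u := by
    clear hy
    induction u using TensorProduct.induction_on with
    | zero => rw [map_zero, map_zero, smul_zero]
    | tmul c t =>
      rw [LinearMap.baseChange_tmul, LinearMap.baseChange_tmul, Submodule.subtype_apply, hgq t,
        TensorProduct.tmul_smul, Rat.cast_smul_eq_qsmul]
    | add u₁ u₂ h₁ h₂ => rw [map_add, map_add, h₁, h₂, smul_add]
  rw [hg, hgx, map_smul]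

/-! ### The Hodge conjecture for `S × S` -/

/-- **The Hodge conjecture for `S × S`, `S` a smooth projective complex surface with `h^{2,0}(S) = 1` and
`b₂(S) − ρ(S)` an odd prime.** Here `h^{2,0}(S) = 1` is "the `(2,0)`-classes of `H²(S(ℂ); ℂ)` form the
line `ℂσ`, `σ ≠ 0`", and `b₂ − ρ = dim_ℂ H²(S(ℂ); ℂ) − dim_ℂ N¹H²(S(ℂ); ℂ)` is the rank of the
transcendental lattice. Then `End_Hdg(T(S)) = ℚ` (`hodgeEndomorphisms_scalar`: no real or complex
multiplication in odd prime rank), and the marking-free bookkeeping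
`SquareGlueFree.hodgeConjectureFor_square_of_hodgeEndomorphisms_scalar` (Künneth, the diagonal, Lefschetz
`(1,1)`, Deligne's `N¹ ∩ Hdg = alg` in codimension `2`, hard Lefschetz) gives `HodgeConjectureFor 4 (S ⊗ S)`
in every codimension. [cite: Huybrechts2016K3, Ch. 3 Rem. 3.3.14 (ii), (3.2) and Lemma 3.1]
[cite: Vangeemen2008, Lemma 3.2] [cite: Varesco2023, §2 (p. 8)] -/
theorem hodgeConjectureFor_square_of_prime (hS : IsSmoothProjective 2 S) {σ : complexBetti S (2 * 1)}
    (hσ : IsOfHodgeType 2 S (2 * 1) 2 0 σ) (hσ0 : σ ≠ 0)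
    (hline : ∀ c : complexBetti S (2 * 1), IsOfHodgeType 2 S (2 * 1) 2 0 c → ∃ t : ℂ, c = t • σ)
    (hp : (Module.finrank ℂ (complexBetti S (2 * 1)) - Module.finrank ℂ (algebraicClasses S 1)).Prime)
    (hodd : Odd (Module.finrank ℂ (complexBetti S (2 * 1)) - Module.finrank ℂ (algebraicClasses S 1))) :
    HodgeConjectureFor 4 (S ⊗ S) :=
  NikulinTwinTransport.SquareGlueFree.hodgeConjectureFor_square_of_hodgeEndomorphisms_scalar hS
    fun f hf₁ hf₂ _ hf₄ ↦ hodgeEndomorphisms_scalar hS hσ hσ0 hline hp hodd f hf₁ hf₂ hf₄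

/-- **The Hodge conjecture for `S × S`, `S` a complex projective K3 surface with `b₂(S) − ρ(S)` an odd
prime** — i.e., as `b₂ = 22`, of Picard number `ρ(S) ∈ {3, 5, 9, 11, 15, 17, 19}` (the rank of `T(S)`
being then an odd prime, `T(S)` has no real or complex multiplication). For the tree's `IsK3Surface`
(smooth projective surface, `H¹(𝒪) = 0`, a nowhere vanishing holomorphic `2`-form): `h^{2,0} = 1` by
`IsK3Surface.twoZero_line` and `IsK3Surface.exists_isOfHodgeType_twoZero_ne_zero` (Voisin I Cor. 7.6,
`Voisin2002_closedForm_top_zero_not_exact_holds`). [cite: Huybrechts2016K3, Ch. 3 Rem. 3.3.14 (ii) and Ch. 1 (2.7)]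
[cite: Vangeemen2008, Lemma 3.2] -/
theorem hodgeConjectureFor_square_of_isK3Surface_of_prime (hK3 : IsK3Surface S)
    (hp : (Module.finrank ℂ (complexBetti S (2 * 1)) - Module.finrank ℂ (algebraicClasses S 1)).Prime)
    (hodd : Odd (Module.finrank ℂ (complexBetti S (2 * 1)) - Module.finrank ℂ (algebraicClasses S 1))) :
    HodgeConjectureFor 4 (S ⊗ S) := by
  obtain ⟨σ, hσ0, hσ⟩ := hK3.exists_isOfHodgeType_twoZero_ne_zero
    (fun E _ _ _ M _ _ ↦ Voisin2002_closedForm_top_zero_not_exact_holds E M)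
  exact hodgeConjectureFor_square_of_prime hK3.isSmoothProjective hσ hσ0 (hK3.twoZero_line hσ hσ0) hp hodd


/-! ### Variants: `h^{2,0} = 1` read in a Hodge model; K3 surfaces of Picard number `17` and `19` -/

/-- **`h^{2,0}(S) = 1` read in a Hodge model gives the line of `(2,0)`-classes**: if
`dim_ℂ H^{2,0}_A = 1` for some Hodge model `A` of the surface `S` (the clause of crux `K3TypeNets`), then
the classes of type `(2,0)` in `H²(S(ℂ); ℂ)` form a line `ℂσ`, `σ ≠ 0` (the comparison
`A^* : H²(S(ℂ); ℂ) ≅ H²(S^an; ℂ)` is an isomorphism and all models cut out the same `H^{2,0}`,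
`hodgePQ_independent_of_hodgeModel_holds`). [cite: VoisinHodgeI2002, §6.1.3 Prop. 6.11 and §7.1.1] -/
theorem exists_twoZero_line_of_finrank_hodgePQ_eq_one (hS : IsSmoothProjective 2 S) (A : HodgeModel 2 S)
    (h1 : Module.finrank ℂ (A.hodgePQ 2 2 0) = 1) :
    ∃ σ : complexBetti S (2 * 1), IsOfHodgeType 2 S (2 * 1) 2 0 σ ∧ σ ≠ 0 ∧
      ∀ c : complexBetti S (2 * 1), IsOfHodgeType 2 S (2 * 1) 2 0 c → ∃ t : ℂ, c = t • σ := by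
  have hI := hodgePQ_independent_of_hodgeModel_holds
  have h1' : Module.finrank ℂ (A.hodgePQ (2 * 1) 2 0) = 1 := h1
  obtain ⟨v, hv0, hv⟩ := finrank_eq_one_iff'.1 h1'
  set σ : complexBetti S (2 * 1) := (A.pullbackEquiv (2 * 1)).symm (v : _) with hσdef
  have hσA : A.pullback (2 * 1) σ = v := by
    rw [← A.pullbackEquiv_apply, hσdef, LinearEquiv.apply_symm_apply]
  refine ⟨σ, ⟨A, by rw [hσA]; exact v.2⟩, fun h ↦ hv0 ?_, fun c hc ↦ ?_⟩
  · apply Subtype.ext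
    rw [← hσA, h, map_zero, Submodule.coe_zero]
  · have hcA : A.pullback (2 * 1) c ∈ A.hodgePQ (2 * 1) 2 0 := (hI.isOfHodgeType_iff hS A).1 hc
    obtain ⟨t, ht⟩ := hv ⟨_, hcA⟩
    refine ⟨t, (A.pullbackEquiv (2 * 1)).injective ?_⟩
    have ht' := congrArg Subtype.val ht
    simp only [Submodule.coe_smul] at ht'
    rw [A.pullbackEquiv_apply, A.pullbackEquiv_apply, map_smul, hσA, ht']

/-- **The Hodge conjecture for `S × S` from `dim H^{2,0}_A = 1` in a Hodge model** — the form in which crux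
`K3TypeNets` (stmt-HodgeConjecture-11600) phrases "`h^{2,0} = 1`" — and `b₂(S) − ρ(S)` an odd prime.
[cite: Huybrechts2016K3, Ch. 3 Rem. 3.3.14 (ii) and (3.2)] [cite: Vangeemen2008, Lemma 3.2] -/
theorem hodgeConjectureFor_square_of_finrank_hodgePQ_eq_one (hS : IsSmoothProjective 2 S) (A : HodgeModel 2 S)
    (h1 : Module.finrank ℂ (A.hodgePQ 2 2 0) = 1)
    (hp : (Module.finrank ℂ (complexBetti S (2 * 1)) - Module.finrank ℂ (algebraicClasses S 1)).Prime)
    (hodd : Odd (Module.finrank ℂ (complexBetti S (2 * 1)) - Module.finrank ℂ (algebraicClasses S 1))) :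
    HodgeConjectureFor 4 (S ⊗ S) := by
  obtain ⟨σ, hσ, hσ0, hline⟩ := exists_twoZero_line_of_finrank_hodgePQ_eq_one hS A h1
  exact hodgeConjectureFor_square_of_prime hS hσ hσ0 hline hp hodd

/-- **K3 surfaces of Picard number `17` or `19`, granted `b₂ = 22`**: two of the Picard numbers `≥ 17` of
the support item `ELineTransport.HighPicardSquares` (stmt-HodgeConjecture-12553), whose K3 clause is
`IsK3Surface` verbatim. CONDITIONAL on the tree's named fact `K3_finrank_complexBetti_two` (`b₂(S) = 22`,
Noether's formula; not yet discharged): then `rk T(S) = 22 − ρ ∈ {5, 3}` is an odd prime and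
`hodgeConjectureFor_square_of_isK3Surface_of_prime` applies. (Picard numbers `18` and `20` — rank `4` and
`2` — may carry complex multiplication and are not covered here.) [cite: Huybrechts2016K3, Ch. 1 §3.3 and Ch. 3 Rem. 3.3.14 (ii)]
[cite: Vangeemen2008, Lemma 3.2] -/
theorem hodgeConjectureFor_square_of_isK3Surface_of_picard (h22 : K3_finrank_complexBetti_two)
    (hK3 : IsK3Surface S)
    (hρ : Module.finrank ℂ (algebraicClasses S 1) = 17 ∨ Module.finrank ℂ (algebraicClasses S 1) = 19) :
    HodgeConjectureFor 4 (S ⊗ S) := by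
  have hb : Module.finrank ℂ (complexBetti S (2 * 1)) = 22 := h22 S hK3
  refine hodgeConjectureFor_square_of_isK3Surface_of_prime hK3 ?_ ?_
  · rcases hρ with h | h <;> rw [hb, h] <;> norm_num
  · rcases hρ with h | h <;> rw [hb, h] <;> decide

end Summit.HodgeConjecture.HodgeConjecture.Theorems.OddPrimeSquares

end
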